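import Summits.RiemannHypothesis.RiemannHypothesis.Theses.NymanBeurling
import Summits.RiemannHypothesis.RiemannHypothesis.Theorems.NymanBeurlingNbThesisLowerBound

/-!
# RiemannHypothesis / NymanBeurling — crux #3 `NbMoebiusMollifier` is a `liminf` statement

Route `RiemannHypothesis/NymanBeurling`, crux #3 `NbMoebiusMollifier` (item
stmt-RiemannHypothesis-0395): for every `ε > 0` there is `N` with

  `I(N) := ∫⁻ ‖1 - ζ(1/2+it) V_N(1/2+it)‖² dt/(1/4+t²) < ε`,
  `V_N(s) = Σ_{k≤N} μ(k)(1 - log k/log N) k^{-s}` (the smoothed Möbius / "Selberg" polynomial).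

Unlike the thesis `NbThesis` (an infimum over all polynomials, non-increasing in `N`), the
sequence `I(N)` of a FIXED family of polynomials has no monotonicity, and the item quantifies
`∃ N` without a largeness condition. This file pins down what the item therefore says:

* `nb_lintegral_pos` — unconditionally every distance integral of the route is `> 0` (for every
  `N` and every coefficient vector; from the BDBLS floor `nbIntegrand_lowerBound`), in particular
  every `I(N) > 0` (`nbMoebius_lintegral_pos`);
* `frequently_lt_of_forall_exists_lt` — for a positive sequence, "`∀ ε, ∃ N, f N < ε`" already
  forces "`∀ ε, ∃ᶠ N, f N < ε`" (finitely many positive values have a positive minimum);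
* `nbMoebiusMollifier_iff_frequently` — hence `NbMoebiusMollifier ↔ ∀ ε > 0, ∃ᶠ N → ∞, I(N) < ε`:
  crux #3 asserts exactly `liminf_N I(N) = 0`, i.e. that SOME subsequence of the Möbius-mollifier
  distances tends to `0` — weaker than the `lim` of [BettinConreyFarmer2013, Thm. 1] (there, under
  RH and their hypothesis (2), `I(N) ~ 2π(2+γ-log 4π)/log N`). A refutation of crux #3 (under any
  hypothesis) must therefore bound `I(N)` below along ALL large `N`.

References: S. Bettin, J. B. Conrey, D. W. Farmer, Proc. Steklov Inst. 280 (2013), Thm. 1;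
L. Báez-Duarte, M. Balazard, B. Landreau, E. Saias, Adv. Math. 149 (2000) (the floor).
-/

noncomputable section

open Complex Filter Topology MeasureTheory
open scoped Real ENNReal

namespace Summit.RiemannHypothesis.RiemannHypothesis.Theorems

open Summit.RiemannHypothesis.RiemannHypothesis.Theses.NymanBeurling

/-- **Every distance integral of the route is positive**, unconditionally: for every `N` and
every `a : Fin N → ℂ`, `0 < ∫⁻ ‖1 - ζA‖²/(1/4+t²)` (it is at least the BDBLS floor
`C / log (max N 2) > 0`, `nbIntegrand_lowerBound`). [BDBLS2000] -/
theorem nb_lintegral_pos {N : ℕ} (a : Fin N → ℂ) :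
    0 < ∫⁻ t : ℝ, ENNReal.ofReal (‖1 - riemannZeta (1 / 2 + t * I) *
        ∑ n : Fin N, a n * ((n : ℂ) + 1) ^ (-(1 / 2 + t * I))‖ ^ 2 / (1 / 4 + t ^ 2)) := by
  obtain ⟨C, hC, h⟩ := nbIntegrand_lowerBound
  refine lt_of_lt_of_le (ENNReal.ofReal_pos.mpr (div_pos hC (Real.log_pos ?_))) (h N a)
  exact lt_of_lt_of_le one_lt_two (le_max_right _ _)

/-- In particular every Möbius-mollifier distance `I(N) = ∫⁻ ‖1 - ζV_N‖²/(1/4+t²)` of crux #3 is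
positive. [BDBLS2000] -/
theorem nbMoebius_lintegral_pos (N : ℕ) :
    0 < ∫⁻ t : ℝ, ENNReal.ofReal (‖1 - riemannZeta (1 / 2 + t * I) *
        ∑ n : Fin N, ((ArithmeticFunction.moebius (n + 1) : ℝ) *
          (1 - Real.log ((n : ℝ) + 1) / Real.log N) : ℂ) * ((n : ℂ) + 1) ^ (-(1 / 2 + t * I))‖ ^ 2 /
            (1 / 4 + t ^ 2)) :=
  nb_lintegral_pos _

/-- **Positive sequences: `∀ ε ∃ N` upgrades to `∀ ε ∃ᶠ N`.** If `f : ℕ → ℝ≥0∞` is pointwise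
positive and takes values below every `ε > 0`, then it does so for arbitrarily large indices
(the finitely many values `f 0, …, f (N₀-1)` have a positive lower bound `δ ≤ ε`; a value below
`δ` must occur at an index `≥ N₀`). [folklore] -/
theorem frequently_lt_of_forall_exists_lt {f : ℕ → ℝ≥0∞} (hpos : ∀ N, 0 < f N)
    (h : ∀ ε : ℝ, 0 < ε → ∃ N, f N < ENNReal.ofReal ε) :
    ∀ ε : ℝ, 0 < ε → ∃ᶠ N in atTop, f N < ENNReal.ofReal ε := by
  intro ε hε
  rw [frequently_atTop]
  intro N₀
  -- a positive real `δ ≤ ε` below `f 0, …, f (N₀ - 1)`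
  have key : ∃ δ : ℝ, 0 < δ ∧ δ ≤ ε ∧ ∀ N, N < N₀ → ENNReal.ofReal δ ≤ f N := by
    induction N₀ with
    | zero => exact ⟨ε, hε, le_rfl, fun N hN ↦ (Nat.not_lt_zero N hN).elim⟩
    | succ k ih =>
      obtain ⟨δ, hδ, hδε, hk⟩ := ih
      by_cases htop : f k = ⊤
      · refine ⟨δ, hδ, hδε, fun N hN ↦ ?_⟩
        rcases Nat.lt_succ_iff_lt_or_eq.mp hN with hN' | rfl
        · exact hk N hN'
        · rw [htop]; exact le_top
      · refine ⟨min δ (f k).toReal, lt_min hδ (ENNReal.toReal_pos (hpos k).ne' htop),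
          (min_le_left _ _).trans hδε, fun N hN ↦ ?_⟩
        rcases Nat.lt_succ_iff_lt_or_eq.mp hN with hN' | rfl
        · exact (ENNReal.ofReal_le_ofReal (min_le_left _ _)).trans (hk N hN')
        · calc ENNReal.ofReal (min δ (f N).toReal)
              ≤ ENNReal.ofReal (f N).toReal := ENNReal.ofReal_le_ofReal (min_le_right _ _)
            _ = f N := ENNReal.ofReal_toReal htop
  obtain ⟨δ, hδ, hδε, hlow⟩ := key
  obtain ⟨N, hN⟩ := h δ hδ
  exact ⟨N, not_lt.mp fun hlt ↦ (lt_irrefl _) ((hlow N hlt).trans_lt hN),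
    hN.trans_le (ENNReal.ofReal_le_ofReal hδε)⟩

/-- **Crux #3 is a `liminf` statement.** `NbMoebiusMollifier` holds iff for every `ε > 0` the
Möbius-mollifier distance `I(N) = ∫⁻ ‖1 - ζ(1/2+it)V_N(1/2+it)‖² dt/(1/4+t²)` drops below `ε` for
arbitrarily large `N` — i.e. iff `liminf_N I(N) = 0`, iff some subsequence of `I(N)` tends to `0`
(each `I(N)` being `> 0`, `nbMoebius_lintegral_pos`). Weaker than the full limit
`I(N) ~ 2π(2+γ-log 4π)/log N` of Bettin–Conrey–Farmer (RH + their hypothesis (2)).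
[BettinConreyFarmer2013, Thm. 1 (comparison)] -/
theorem nbMoebiusMollifier_iff_frequently :
    NbMoebiusMollifier ↔ ∀ ε : ℝ, 0 < ε → ∃ᶠ N : ℕ in atTop,
      ∫⁻ t : ℝ, ENNReal.ofReal (‖1 - riemannZeta (1 / 2 + t * I) *
        ∑ n : Fin N, ((ArithmeticFunction.moebius (n + 1) : ℝ) *
          (1 - Real.log ((n : ℝ) + 1) / Real.log N) : ℂ) * ((n : ℂ) + 1) ^ (-(1 / 2 + t * I))‖ ^ 2 /
            (1 / 4 + t ^ 2)) < ENNReal.ofReal ε := by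
  unfold NbMoebiusMollifier
  constructor
  · intro h
    exact frequently_lt_of_forall_exists_lt nbMoebius_lintegral_pos h
  · intro h ε hε
    exact (h ε hε).exists

end Summit.RiemannHypothesis.RiemannHypothesis.Theorems

end
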